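import Summits.AtomisticToContinuum.Crystallization.Theorems.ChargedEnergyGapCoherencePricing
import Summits.AtomisticToContinuum.Crystallization.Theorems.ChargedEnergyGapCoolSeparation
import HarnessLib

/-!
# `ChargedEnergyGap` — the GUARDED gross-side chain: every piece of the lineage's dial may assume the cool hard-core guard
# (cell `decomp-a2c`, lens 3, generation 49, node «NeighbourhoodLedger», part L-B; over parts H-B′ and K-B / L-A)

Generation 48 proved that the guard is free (`ChargedEnergyGap ↔ GrossChargeGapG ∧ ChartedChargePricingG`, part K-B; at
`s ≤ 3/5` by part L-A) but left the gross-side DIAL CHAIN — exposure ▸ rigidity ▸ deep rigidity ▸ reach ▸ coherence ▸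
gross debit (parts A…H-B′, all typed `∀ Q`) — unguarded (memo §3 of generation 48).  This file threads the guard through
the chain ONCE, generically, so that every open leaf of the lineage may be attacked in its GUARDED form (no rattlers, points
pairwise `≥ s`; record `s = 3/5`):

§1 `SpeciesPricingG ε s c := ∃ κ > 0, ∀ Q, Guard ε s Q → κ·c(Q) ≤ excess Q` with the bookkeeping of the tree's
   `SpeciesPricing` (congr / mono / add / add_iff; unguarded ⟹ guarded).
§2 ★ `Guard.of_points_eq` — THE GUARD READS ONLY THE POINT SET (a motif site of another presentation of `Q.points` is a
   lattice translate of a motif site of `Q`, and site energies are presentation- and period-invariant); hence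
   `Guard.of_isSupercell`, and ★★ the SUPERCELL TRANSFER SURVIVES THE GUARD: `deepImprovablePricingG_of_improvablePricingG`
   (`IP_G ⟹ DIP_G ⟹ SRP_G`, part F-B's proof with the guard transported to the supercell).
§3 the guarded pieces `EGP_G, IP_G, SRP_G, DIP_G, FCP_G, CCP_G, NCP_G` (species pricings of the lineage's counts) and the
   guarded maximal debit `NGP_G`; ★★ `incoherentCorePricingG_of_grossDebitG` (part H-B′'s closing of the one-way debit,
   pointwise under the guard); ★★ `grossChargeGapG_iff_sixG` (the six-species census, exact under the guard) and
   `grossChargeGapG_iff_guardedChain_record : GrossChargeGapG (3/20) (1/10) s ⟺ IP_G ∧ FCP_G ∧ CCP_G ∧ NGP_G` (every `s`;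
   `EGP_G` from the tree's PROVED `exposedGrossPricing_record`).
§4 ★★ RECORD CONES BY NAME: `chargedEnergyGap_of_guardedChain` (`s ≤ 3/5`: `ChargeRecount → IP_G → FCP_G → CCP_G → NGP_G →
   P_G → ChargedEnergyGap`) and the EXACT NODE `chargedEnergyGap_iff_guardedChain_record35` at `s = 3/5`; WEAKER certificates
   (crux ⟹ unguarded piece ⟹ guarded piece) for every leaf.  Part L-C re-types the localised ledger (BALL / FAR) under the
   guard with neighbourhood debits and closes it against `NGP_G`.

TAGS.  Every `_G` piece: WEAKER than its unguarded namesake BY NAME (`speciesPricingG_of_speciesPricing`), hence than the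
crux; EGP_G PROVED; SRP_G / DIP_G PROVED FROM IP_G; IP_G TRUE-type · ATTACKABLE-L (as IP; the guard bounds local cardinalities
a priori: `≤ (2ρ/s+1)³` points in any `ρ`-ball); FCP_G / CCP_G DECLARED SUB-RESIDUALS (as FCP / CCP; conjecturally vacuous);
NGP_G = NCP_G-with-debit, THE ENGINE TARGET, now free of the rim flower's unbounded crowders (memo g48 §1: crowders closer than
`3/5` are hot and gone; the remaining bounded crowding is what part L-C's neighbourhood debit pays for).
All `[this work]` = cell decomp-a2c lens 3; ingredients `[folklore]` from the tree as named.
-/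

noncomputable section

open scoped BigOperators
open Literature.MathematicalPhysics.StatisticalMechanics
open Literature.Geometry.DiscreteGeometry
open Summit.AtomisticToContinuum.Crystallization.Theses.PricedLinkCensus
open Summit.AtomisticToContinuum.Crystallization.Theorems.ChargedEnergyGapNegative

namespace Summit.AtomisticToContinuum.Crystallization.Theorems.ChargedEnergyGapChartDial

/-! ## §1 Guarded species pricing -/

section SpeciesG

variable {ε s : ℝ}

/-- **Guarded pricing of a motif-site count** `c`: `∃ κ > 0, ∀ Q, Guard ε s Q → κ·c(Q) ≤ #F·(e(Q) − e*)`. -/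
def SpeciesPricingG (ε s : ℝ) (c : PeriodicConfiguration 3 → ℕ) : Prop :=
  ∃ κ : ℝ, 0 < κ ∧ ∀ Q : PeriodicConfiguration 3, Guard ε s Q → κ * (c Q : ℝ) ≤ excess Q

/-- Unguarded pricing is guarded pricing (any guard): every `_G` piece is WEAKER than its namesake. -/
theorem speciesPricingG_of_speciesPricing {c : PeriodicConfiguration 3 → ℕ} (ε s : ℝ) (h : SpeciesPricing c) :
    SpeciesPricingG ε s c := by
  obtain ⟨κ, hκ, h⟩ := h
  exact ⟨κ, hκ, fun Q _ => h Q⟩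

/-- `GrossChargeGapG` is the guarded pricing of the gross charged count (definitional). -/
theorem grossChargeGapG_iff_speciesPricingG (θ ε s : ℝ) :
    GrossChargeGapG θ ε s ↔ SpeciesPricingG ε s (motifChargedGross θ) := Iff.rfl

/-- Equal counts have the same guarded pricing. -/
theorem speciesPricingG_congr {c c' : PeriodicConfiguration 3 → ℕ} (h : ∀ Q, c Q = c' Q) :
    SpeciesPricingG ε s c ↔ SpeciesPricingG ε s c' := by
  obtain rfl : c = c' := funext h
  exact Iff.rfl

/-- A smaller count inherits the guarded pricing. -/
theorem SpeciesPricingG.mono {c c' : PeriodicConfiguration 3 → ℕ} (h : SpeciesPricingG ε s c) (hle : ∀ Q, c' Q ≤ c Q) :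
    SpeciesPricingG ε s c' := by
  obtain ⟨κ, hκ, hc⟩ := h
  exact ⟨κ, hκ, fun Q hQ => (mul_le_mul_of_nonneg_left (Nat.cast_le.2 (hle Q)) hκ.le).trans (hc Q hQ)⟩

/-- A stronger guard (larger separation demanded) prices fewer configurations. -/
theorem SpeciesPricingG.mono_sep {s' : ℝ} {c : PeriodicConfiguration 3 → ℕ} (hs : s ≤ s') (h : SpeciesPricingG ε s c) :
    SpeciesPricingG ε s' c := by
  obtain ⟨κ, hκ, hc⟩ := h
  exact ⟨κ, hκ, fun Q hQ => hc Q (hQ.anti hs)⟩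

/-- Two guarded-priced counts are priced together (constant `min(κ₁, κ₂)/2`). -/
theorem SpeciesPricingG.add {c₁ c₂ : PeriodicConfiguration 3 → ℕ} (h₁ : SpeciesPricingG ε s c₁)
    (h₂ : SpeciesPricingG ε s c₂) : SpeciesPricingG ε s (fun Q => c₁ Q + c₂ Q) := by
  obtain ⟨κ₁, hκ₁, h₁⟩ := h₁
  obtain ⟨κ₂, hκ₂, h₂⟩ := h₂
  refine ⟨min κ₁ κ₂ / 2, by positivity, fun Q hQ => ?_⟩
  have hc1 : (0 : ℝ) ≤ c₁ Q := Nat.cast_nonneg _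
  have hc2 : (0 : ℝ) ≤ c₂ Q := Nat.cast_nonneg _
  have hm1 := mul_le_mul_of_nonneg_right (min_le_left κ₁ κ₂) hc1
  have hm2 := mul_le_mul_of_nonneg_right (min_le_right κ₁ κ₂) hc2
  push_cast
  linarith [h₁ Q hQ, h₂ Q hQ]

/-- **Additivity of guarded pricing**: a sum of counts is guarded-priced iff both summands are. -/
theorem speciesPricingG_add_iff (c₁ c₂ : PeriodicConfiguration 3 → ℕ) :
    SpeciesPricingG ε s (fun Q => c₁ Q + c₂ Q) ↔ SpeciesPricingG ε s c₁ ∧ SpeciesPricingG ε s c₂ :=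
  ⟨fun h => ⟨h.mono fun _ => Nat.le_add_right _ _, h.mono fun _ => Nat.le_add_left _ _⟩, fun h => h.1.add h.2⟩

end SpeciesG

/-! ## §2 The guard reads only the point set; the supercell transfer survives the guard -/

section Transfer

/-- ★ **THE GUARD READS ONLY THE POINT SET**: two presentations of one point set are guarded together. -/
theorem Guard.of_points_eq {ε s : ℝ} {Q P : PeriodicConfiguration 3} (hQ : Guard ε s Q) (h : P.points = Q.points) :
    Guard ε s P := by
  refine ⟨fun x hx => ?_, fun p hp q hq hpq => hQ.2 p (h ▸ hp) q (h ▸ hq) hpq⟩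
  have hxQ : (x : E3) ∈ Q.points := h ▸ P.mem_points_of_mem_motif x.2
  obtain ⟨y, hy, g, hg, hxy⟩ := hxQ
  have h1 : siteEnergy P (x : E3) = siteEnergy Q (x : E3) := by
    simp only [siteEnergy]; rw [h]
  have h2 : siteEnergy P (x : E3) = siteEnergy Q y := by
    rw [h1, hxy, siteEnergy_add_period Q hg y]
  refine hQ.1 ⟨y, hy⟩ ?_
  unfold Rattler at hx ⊢
  rwa [h2] at hx

/-- Hence a supercell presentation of a guarded configuration is guarded. -/
theorem Guard.of_isSupercell {ε s : ℝ} {k : ℕ} {Q P : PeriodicConfiguration 3} (hQ : Guard ε s Q)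
    (hS : IsSupercell k Q P) : Guard ε s P :=
  hQ.of_points_eq hS.1

variable (θ ε R r η : ℝ)

/-- piece IP_G · WEAKER than IP · TRUE-type · ATTACKABLE-L.  **Guarded improvable pricing.** -/
def ImprovablePricingG (s : ℝ) : Prop := SpeciesPricingG ε s (motifCompactImprovable θ ε R r η)

/-- piece DIP_G · PROVED FROM IP_G (`deepImprovablePricingG_of_improvablePricingG`).  **Guarded deeply-improvable pricing.** -/
def DeepImprovablePricingG (s : ℝ) : Prop := SpeciesPricingG ε s (motifCompactDeepImprovable θ ε R r η)

/-- piece SRP_G · PROVED FROM IP_G.  **Guarded shallow-rigid pricing.** -/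
def ShallowRigidPricingG (s : ℝ) : Prop := SpeciesPricingG ε s (motifCompactShallow θ ε R r η)

variable {θ ε R r η}

/-- ★★ **THE SUPERCELL TRANSFER SURVIVES THE GUARD**: `IP_G ⟹ DIP_G`, same constant (part F-B's proof; the one common supercell
presentation `P` of `Q.points` to which `IP_G` is applied is guarded by `Guard.of_isSupercell`). -/
theorem deepImprovablePricingG_of_improvablePricingG {s : ℝ} (h : ImprovablePricingG θ ε R r η s) :
    DeepImprovablePricingG θ ε R r η s := by
  obtain ⟨κ, hκ, hIP⟩ := h
  refine ⟨κ, hκ, fun Q hQ => ?_⟩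
  set T := {x : Q.motif // ((Charged Q x ∧ ¬ ChartedAt θ Q (pt Q x)) ∧ ¬ Exposed ε R Q x) ∧ DeepImprovable r η Q x}
    with hT
  choose k₁ hk₁pos hk₁ using fun x : T => x.2.2
  obtain ⟨M, hM⟩ := Finite.bddAbove_range k₁
  have hMk : ∀ x : T, k₁ x ≤ M + 1 := fun x => (hM ⟨x, rfl⟩).trans (Nat.le_succ M)
  obtain ⟨P, hP, hE⟩ := exists_isSupercell Q (Nat.succ_pos M)
  have hper : ∀ g ∈ Q.lattice, ∀ q : E3, q + g ∈ P.points ↔ q ∈ P.points := fun g hg q => by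
    rw [hP.1]; exact add_mem_points_iff Q hg q
  set S : E3 → Prop := fun p => CompactGrossAt θ ε R Q p ∧ ImprovableAt r η P p with hS
  have hSQ : ∀ p, ∀ g ∈ Q.lattice, (S (p + g) ↔ S p) := fun p g hg =>
    and_congr (compactGrossAt_add_period θ ε R Q hg p) (improvableAt_add_iff (hper g hg) p)
  have hSP : ∀ p, ∀ g ∈ P.lattice, (S (p + g) ↔ S p) := fun p g hg => hSQ p g (hP.mem_lattice hg)
  have h1 : Nat.card T ≤ Nat.card {x : Q.motif // S x} :=
    Nat.card_le_card_of_injective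
      (fun x => ⟨x.1, (compactGrossAt_coe_iff θ ε R Q x.1).2 x.2.1, hk₁ x (M + 1) (hMk x) P hP⟩)
      fun _ _ hab => Subtype.ext (Subtype.mk.inj hab)
  have h2 : Nat.card {x : P.motif // S x} = motifCompactImprovable θ ε R r η P :=
    Nat.card_congr (Equiv.subtypeEquivRight fun x =>
      and_congr ((compactGrossAt_congr_points θ ε R hP.1 (x : E3)).symm.trans (compactGrossAt_coe_iff θ ε R P x))
        (improvable_iff_improvableAt r η P x).symm)
  have h3 := card_mul_natCard_motif_eq_of_points_eq P Q hP.1 hSP hSQ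
  have h4 := card_mul_excess_eq P Q hE
  -- the one guarded step: `IP_G` at the supercell, which is guarded
  have hIPP : κ * (Nat.card {x : P.motif // S x} : ℝ) ≤ excess P := by rw [h2]; exact hIP P (hQ.of_isSupercell hP)
  have hFP : (0 : ℝ) < P.motif.card := by exact_mod_cast P.motif_nonempty.card_pos
  have h5 : (P.motif.card : ℝ) * (κ * Nat.card {x : Q.motif // S x}) ≤ (P.motif.card : ℝ) * excess Q :=
    calc (P.motif.card : ℝ) * (κ * Nat.card {x : Q.motif // S x})
        = κ * ((P.motif.card : ℝ) * Nat.card {x : Q.motif // S x}) := by ring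
      _ = κ * ((Q.motif.card : ℝ) * Nat.card {x : P.motif // S x}) := by rw [h3]
      _ = (Q.motif.card : ℝ) * (κ * Nat.card {x : P.motif // S x}) := by ring
      _ ≤ (Q.motif.card : ℝ) * excess P := mul_le_mul_of_nonneg_left hIPP (Nat.cast_nonneg _)
      _ = (P.motif.card : ℝ) * excess Q := h4
  have h6 : κ * (Nat.card {x : Q.motif // S x} : ℝ) ≤ excess Q := le_of_mul_le_mul_left h5 hFP
  exact (mul_le_mul_of_nonneg_left (Nat.cast_le.2 h1) hκ.le).trans h6

/-- ★ `SRP_G` is a consequence of `IP_G`: shallow-rigid sites leave the residual at no cost, under the guard too. -/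
theorem shallowRigidPricingG_of_improvablePricingG {s : ℝ} (h : ImprovablePricingG θ ε R r η s) :
    ShallowRigidPricingG θ ε R r η s :=
  (deepImprovablePricingG_of_improvablePricingG h).mono (motifCompactShallow_le_deepImprovable θ ε R r η)

end Transfer

/-! ## §3 The guarded pieces of the reach and coherence dials; the guarded debit closes; the census is exact -/

section Chain

variable (θ ε R r η L δ L' : ℝ)

/-- piece EGP_G · PROVED at the record (`exposedGrossPricingG_record`).  **Guarded exposed gross pricing.** -/
def ExposedGrossPricingG (s : ℝ) : Prop := SpeciesPricingG ε s (motifGrossExposed θ ε R)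

/-- piece FCP_G · WEAKER than FCP · DECLARED SUB-RESIDUAL.  **Guarded frustrated core pricing.** -/
def FrustratedCorePricingG (s : ℝ) : Prop := SpeciesPricingG ε s (motifCoreFrustrated θ ε R r η L)

/-- piece CCP_G · WEAKER than CCP · DECLARED SUB-RESIDUAL #2.  **Guarded coherent core pricing.** -/
def CoherentCorePricingG (s : ℝ) : Prop := SpeciesPricingG ε s (motifCoreCoherent θ ε R r η L δ L')

/-- piece NCP_G · WEAKER than NCP · the engine target, debit-free form.  **Guarded incoherent core pricing.** -/
def IncoherentCorePricingG (s : ℝ) : Prop := SpeciesPricingG ε s (motifCoreIncoherent θ ε R r η L δ L')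

/-- piece NGP_G · WEAKER than NGP and than NCP_G · THE ENGINE TARGET under the guard: `κ` per incoherent core of a GUARDED
configuration, up to the excess plus `C` per other gross charged motif site. -/
def IncoherentGrossDebitPricingG (s : ℝ) : Prop :=
  ∃ κ C : ℝ, 0 < κ ∧ 0 ≤ C ∧ ∀ Q : PeriodicConfiguration 3, Guard ε s Q →
    κ * (motifCoreIncoherent θ ε R r η L δ L' Q : ℝ) ≤
      excess Q + C * ((motifChargedGross θ Q : ℝ) - (motifCoreIncoherent θ ε R r η L δ L' Q : ℝ))

variable {θ ε R r η L δ L'}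

/-- ★ `EGP_G` at the exposure record, every `s`: from the tree's PROVED `exposedGrossPricing_record`. -/
theorem exposedGrossPricingG_record (s : ℝ) : ExposedGrossPricingG (3 / 20) (1 / 10) (6 / 5) s :=
  speciesPricingG_of_speciesPricing _ s exposedGrossPricing_record

/-- `NGP_G` is weaker than `NCP_G` (no debit needed). -/
theorem incoherentGrossDebitPricingG_of_incoherentCorePricingG {s : ℝ} (h : IncoherentCorePricingG θ ε R r η L δ L' s) :
    IncoherentGrossDebitPricingG θ ε R r η L δ L' s := by
  obtain ⟨κ, hκ, h⟩ := h
  exact ⟨κ, 0, hκ, le_rfl, fun Q hQ => by rw [zero_mul, add_zero]; exact h Q hQ⟩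

/-- `NGP_G` is weaker than the unguarded `NGP`. -/
theorem incoherentGrossDebitPricingG_of_incoherentGrossDebitPricing (s : ℝ)
    (h : IncoherentGrossDebitPricing θ ε R r η L δ L') : IncoherentGrossDebitPricingG θ ε R r η L δ L' s := by
  obtain ⟨κ, C, hκ, hC, h⟩ := h
  exact ⟨κ, C, hκ, hC, fun Q _ => h Q⟩

/-- ★★ **THE GUARDED ONE-WAY DEBIT CLOSES** (part H-B′'s `incoherentCorePricing_of_grossDebit`, pointwise under the guard):
`EGP_G, IP_G, FCP_G, CCP_G, NGP_G ⟹ NCP_G`, constant `κ / (1 + C Σᵢ 1/κᵢ)`. -/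
theorem incoherentCorePricingG_of_grossDebitG {s : ℝ} (hE : ExposedGrossPricingG θ ε R s) (hI : ImprovablePricingG θ ε R r η s)
    (hF : FrustratedCorePricingG θ ε R r η L s) (hC : CoherentCorePricingG θ ε R r η L δ L' s)
    (hN : IncoherentGrossDebitPricingG θ ε R r η L δ L' s) : IncoherentCorePricingG θ ε R r η L δ L' s := by
  have hS : ShallowRigidPricingG θ ε R r η s := shallowRigidPricingG_of_improvablePricingG hI
  obtain ⟨κ₁, hκ₁, h₁⟩ := hE
  obtain ⟨κ₂, hκ₂, h₂⟩ := hI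
  obtain ⟨κ₃, hκ₃, h₃⟩ := hS
  obtain ⟨κ₄, hκ₄, h₄⟩ := hF
  obtain ⟨κ₅, hκ₅, h₅⟩ := hC
  obtain ⟨κ, C, hκ, hC0, hN⟩ := hN
  obtain ⟨M, hM⟩ : ∃ M : ℝ, M = 1 / κ₁ + 1 / κ₂ + 1 / κ₃ + 1 / κ₄ + 1 / κ₅ := ⟨_, rfl⟩
  have hM0 : 0 ≤ M := by rw [hM]; positivity
  have hden : 0 < 1 + C * M := by positivity
  refine ⟨κ / (1 + C * M), by positivity, fun Q hQ => ?_⟩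
  have hsum : (motifChargedGross θ Q : ℝ) - (motifCoreIncoherent θ ε R r η L δ L' Q : ℝ) =
      motifGrossExposed θ ε R Q + motifCompactImprovable θ ε R r η Q + motifCompactShallow θ ε R r η Q +
        motifCoreFrustrated θ ε R r η L Q + motifCoreCoherent θ ε R r η L δ L' Q := by
    rw [motifChargedGross_eq_six_species θ ε R r η L δ L' Q]; push_cast; ring
  have b₁ : (motifGrossExposed θ ε R Q : ℝ) ≤ excess Q / κ₁ := by rw [le_div_iff₀ hκ₁]; linarith [h₁ Q hQ]
  have b₂ : (motifCompactImprovable θ ε R r η Q : ℝ) ≤ excess Q / κ₂ := by rw [le_div_iff₀ hκ₂]; linarith [h₂ Q hQ]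
  have b₃ : (motifCompactShallow θ ε R r η Q : ℝ) ≤ excess Q / κ₃ := by rw [le_div_iff₀ hκ₃]; linarith [h₃ Q hQ]
  have b₄ : (motifCoreFrustrated θ ε R r η L Q : ℝ) ≤ excess Q / κ₄ := by rw [le_div_iff₀ hκ₄]; linarith [h₄ Q hQ]
  have b₅ : (motifCoreCoherent θ ε R r η L δ L' Q : ℝ) ≤ excess Q / κ₅ := by rw [le_div_iff₀ hκ₅]; linarith [h₅ Q hQ]
  have hD : (motifChargedGross θ Q : ℝ) - (motifCoreIncoherent θ ε R r η L δ L' Q : ℝ) ≤ M * excess Q := by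
    have hx : M * excess Q = excess Q / κ₁ + excess Q / κ₂ + excess Q / κ₃ + excess Q / κ₄ + excess Q / κ₅ := by
      rw [hM]; ring
    rw [hsum, hx]; linarith [b₁, b₂, b₃, b₄, b₅]
  have hmain : κ * (motifCoreIncoherent θ ε R r η L δ L' Q : ℝ) ≤ excess Q + C * (M * excess Q) := by
    linarith [hN Q hQ, mul_le_mul_of_nonneg_left hD hC0]
  rw [div_mul_eq_mul_div, div_le_iff₀ hden]
  linarith [hmain]

/-- ★★ **THE SIX-SPECIES CENSUS IS EXACT UNDER THE GUARD**: `GrossChargeGapG θ ε s ⟺ EGP_G ∧ IP_G ∧ SRP_G ∧ FCP_G ∧ CCP_G ∧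
NCP_G`, every `θ ε R r η L δ L' s`. -/
theorem grossChargeGapG_iff_sixG (θ ε R r η L δ L' s : ℝ) :
    GrossChargeGapG θ ε s ↔ ExposedGrossPricingG θ ε R s ∧ ImprovablePricingG θ ε R r η s ∧ ShallowRigidPricingG θ ε R r η s ∧
      FrustratedCorePricingG θ ε R r η L s ∧ CoherentCorePricingG θ ε R r η L δ L' s ∧
        IncoherentCorePricingG θ ε R r η L δ L' s := by
  unfold ExposedGrossPricingG ImprovablePricingG ShallowRigidPricingG FrustratedCorePricingG CoherentCorePricingG
    IncoherentCorePricingG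
  rw [grossChargeGapG_iff_speciesPricingG,
    speciesPricingG_congr (ε := ε) (s := s) (fun Q => motifChargedGross_eq_six_species θ ε R r η L δ L' Q),
    speciesPricingG_add_iff, speciesPricingG_add_iff, speciesPricingG_add_iff, speciesPricingG_add_iff,
    speciesPricingG_add_iff]
  simp only [and_assoc]

/-- ★ The guarded gross piece from the guarded chain: `EGP_G, IP_G, FCP_G, CCP_G, NGP_G ⟹ GrossChargeGapG θ ε s`. -/
theorem grossChargeGapG_of_guardedChain {s : ℝ} (hE : ExposedGrossPricingG θ ε R s) (hI : ImprovablePricingG θ ε R r η s)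
    (hF : FrustratedCorePricingG θ ε R r η L s) (hC : CoherentCorePricingG θ ε R r η L δ L' s)
    (hN : IncoherentGrossDebitPricingG θ ε R r η L δ L' s) : GrossChargeGapG θ ε s :=
  (grossChargeGapG_iff_sixG θ ε R r η L δ L' s).2
    ⟨hE, hI, shallowRigidPricingG_of_improvablePricingG hI, hF, hC, incoherentCorePricingG_of_grossDebitG hE hI hF hC hN⟩

/-- ★★ **THE WHOLE GUARDED GROSS SIDE AT THE RECORD**, every `s`: `GrossChargeGapG (3/20) (1/10) s ⟺ IP_G ∧ FCP_G ∧ CCP_G ∧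
NGP_G` at `(ε, R, r, η, L, δ, L') = (1/10, 6/5, 10, 1/100, 40, 1/10, 40)`. -/
theorem grossChargeGapG_iff_guardedChain_record (s : ℝ) :
    GrossChargeGapG (3 / 20) (1 / 10) s ↔
      ImprovablePricingG (3 / 20) (1 / 10) (6 / 5) 10 (1 / 100) s ∧
        FrustratedCorePricingG (3 / 20) (1 / 10) (6 / 5) 10 (1 / 100) 40 s ∧
          CoherentCorePricingG (3 / 20) (1 / 10) (6 / 5) 10 (1 / 100) 40 (1 / 10) 40 s ∧
            IncoherentGrossDebitPricingG (3 / 20) (1 / 10) (6 / 5) 10 (1 / 100) 40 (1 / 10) 40 s := by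
  constructor
  · intro hG
    obtain ⟨-, hI, -, hF, hC, hN⟩ := (grossChargeGapG_iff_sixG (3 / 20) (1 / 10) (6 / 5) 10 (1 / 100) 40 (1 / 10) 40 s).1 hG
    exact ⟨hI, hF, hC, incoherentGrossDebitPricingG_of_incoherentCorePricingG hN⟩
  · rintro ⟨hI, hF, hC, hN⟩
    exact grossChargeGapG_of_guardedChain (exposedGrossPricingG_record s) hI hF hC hN

end Chain

/-! ## §4 Record cones by name and WEAKER certificates -/

section Cones

/-- ★★ **RECORD CONE** (every `s ≤ 3/5`), six named leaves: `ChargeRecount · IP_G · FCP_G · CCP_G · NGP_G · P_G ⟹ ChargedEnergyGap`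
at `(θ, ε, R, r, η, L, δ, L') = (3/20, 1/10, 6/5, 10, 1/100, 40, 1/10, 40)`. -/
theorem chargedEnergyGap_of_guardedChain (hF : ChargeRecount) {s : ℝ} (hs : s ≤ 3 / 5)
    (hI : ImprovablePricingG (3 / 20) (1 / 10) (6 / 5) 10 (1 / 100) s)
    (hFc : FrustratedCorePricingG (3 / 20) (1 / 10) (6 / 5) 10 (1 / 100) 40 s)
    (hC : CoherentCorePricingG (3 / 20) (1 / 10) (6 / 5) 10 (1 / 100) 40 (1 / 10) 40 s)
    (hN : IncoherentGrossDebitPricingG (3 / 20) (1 / 10) (6 / 5) 10 (1 / 100) 40 (1 / 10) 40 s)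
    (hP : ChartedChargePricingG (3 / 20) (1 / 10) s) : ChargedEnergyGap :=
  chargedEnergyGap_of_piecesG' hF (by norm_num) eStar_add_tenth_nonpos hs
    ((grossChargeGapG_iff_guardedChain_record s).2 ⟨hI, hFc, hC, hN⟩) hP

/-- WEAKER: `IP_G` is implied by the crux. -/
theorem improvablePricingG_of_chargedEnergyGap (θ ε R r η s : ℝ) (h : ChargedEnergyGap) : ImprovablePricingG θ ε R r η s :=
  speciesPricingG_of_speciesPricing ε s (improvablePricing_of_chargedEnergyGap θ ε R r η h)

/-- WEAKER: `FCP_G` is implied by the crux. -/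
theorem frustratedCorePricingG_of_chargedEnergyGap (θ ε R r η L s : ℝ) (h : ChargedEnergyGap) :
    FrustratedCorePricingG θ ε R r η L s :=
  speciesPricingG_of_speciesPricing ε s (frustratedCorePricing_of_chargedEnergyGap θ ε R r η L h)

/-- WEAKER: `CCP_G` is implied by the crux. -/
theorem coherentCorePricingG_of_chargedEnergyGap (θ ε R r η L δ L' s : ℝ) (h : ChargedEnergyGap) :
    CoherentCorePricingG θ ε R r η L δ L' s :=
  speciesPricingG_of_speciesPricing ε s (coherentCorePricing_of_chargedEnergyGap θ ε R r η L δ L' h)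

/-- WEAKER: `NCP_G` is implied by the crux. -/
theorem incoherentCorePricingG_of_chargedEnergyGap (θ ε R r η L δ L' s : ℝ) (h : ChargedEnergyGap) :
    IncoherentCorePricingG θ ε R r η L δ L' s :=
  speciesPricingG_of_speciesPricing ε s (incoherentCorePricing_of_chargedEnergyGap θ ε R r η L δ L' h)

/-- WEAKER: `NGP_G` is implied by the crux. -/
theorem incoherentGrossDebitPricingG_of_chargedEnergyGap (θ ε R r η L δ L' s : ℝ) (h : ChargedEnergyGap) :
    IncoherentGrossDebitPricingG θ ε R r η L δ L' s :=
  incoherentGrossDebitPricingG_of_incoherentCorePricingG (incoherentCorePricingG_of_chargedEnergyGap θ ε R r η L δ L' s h)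

/-- ★★ **THE EXACT GUARDED NODE AT `s = 3/5`**: `ChargedEnergyGap ⟺ IP_G ∧ FCP_G ∧ CCP_G ∧ NGP_G ∧ P_G` at the record with
`Guard (1/10) (3/5)` (given `ChargeRecount`). -/
theorem chargedEnergyGap_iff_guardedChain_record35 (hF : ChargeRecount) :
    ChargedEnergyGap ↔
      ImprovablePricingG (3 / 20) (1 / 10) (6 / 5) 10 (1 / 100) (3 / 5) ∧
        FrustratedCorePricingG (3 / 20) (1 / 10) (6 / 5) 10 (1 / 100) 40 (3 / 5) ∧
          CoherentCorePricingG (3 / 20) (1 / 10) (6 / 5) 10 (1 / 100) 40 (1 / 10) 40 (3 / 5) ∧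
            IncoherentGrossDebitPricingG (3 / 20) (1 / 10) (6 / 5) 10 (1 / 100) 40 (1 / 10) 40 (3 / 5) ∧
              ChartedChargePricingG (3 / 20) (1 / 10) (3 / 5) :=
  ⟨fun h => ⟨improvablePricingG_of_chargedEnergyGap _ _ _ _ _ _ h, frustratedCorePricingG_of_chargedEnergyGap _ _ _ _ _ _ _ h,
      coherentCorePricingG_of_chargedEnergyGap _ _ _ _ _ _ _ _ _ h, incoherentGrossDebitPricingG_of_chargedEnergyGap _ _ _ _ _ _ _ _ _ h,
      chartedChargePricingG_of_chargedEnergyGap _ _ _ h⟩,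
    fun h => chargedEnergyGap_of_guardedChain hF le_rfl h.1 h.2.1 h.2.2.1 h.2.2.2.1 h.2.2.2.2⟩

/-- The same node with the debit-free `NCP_G` in place of `NGP_G` (`s ≤ 3/5`). -/
theorem chargedEnergyGap_of_guardedChainSplit (hF : ChargeRecount) {s : ℝ} (hs : s ≤ 3 / 5)
    (hI : ImprovablePricingG (3 / 20) (1 / 10) (6 / 5) 10 (1 / 100) s)
    (hFc : FrustratedCorePricingG (3 / 20) (1 / 10) (6 / 5) 10 (1 / 100) 40 s)
    (hC : CoherentCorePricingG (3 / 20) (1 / 10) (6 / 5) 10 (1 / 100) 40 (1 / 10) 40 s)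
    (hN : IncoherentCorePricingG (3 / 20) (1 / 10) (6 / 5) 10 (1 / 100) 40 (1 / 10) 40 s)
    (hP : ChartedChargePricingG (3 / 20) (1 / 10) s) : ChargedEnergyGap :=
  chargedEnergyGap_of_guardedChain hF hs hI hFc hC (incoherentGrossDebitPricingG_of_incoherentCorePricingG hN) hP

end Cones

end Summit.AtomisticToContinuum.Crystallization.Theorems.ChargedEnergyGapChartDial

end
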